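import Summits.ABC.ABC.Theorems.SparseGoodScales.Negative.EveryScale

/-!
# `SparseGoodScales` (stmt-ABC-2161): the exponent `1 + δ` cannot be `1`

Negative support lemmas for the crux `Summit.ABC.ABC.Theses.FeketeScales.SparseGoodScales`
(cdisprove seat, cycle 1), drawn from `Negative/EveryScale.lean` (`liminf_R G(R)/R = +∞`):

* `not_linearGoodScales C` — for NO constant `C` are there arbitrarily large scales `R` with
  `c ≤ C·R` for every abc triple of radical `≤ R`;
* `not_sparseGoodScalesAt_of_nonpos` — the fixed-exponent instance of the crux (its matrix
  `∀ N ∃ R ≥ N ∀ abc, rad ≤ R → c ≤ R^{1+δ}`; the crux is the conjunction over `δ > 0`) is FALSE for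
  every `δ ≤ 0`: the side condition `0 < δ` is load-bearing and sharp;
* `not_sparseGoodScales_uniform` — there is no unbounded set of scales good for all `δ > 0` at once
  (the `∃ R` of the crux must depend on `δ`).
-/

noncomputable section

namespace Summit.ABC.ABC.Theorems.SparseGoodScales.Negative

open Literature.NumberTheory.DiophantineGeometry UniqueFactorizationMonoid

/-! ## Consequences for the crux: `δ ≤ 0` is excluded, linear good scales do not exist -/

/-- **No linear good scales.**  For NO constant `C` are there arbitrarily large scales `R` with
`c ≤ C · R` for every abc triple of radical `≤ R`. [folklore] -/
theorem not_linearGoodScales (C : ℝ) :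
    ¬ ∀ N : ℕ, ∃ R : ℕ, N ≤ R ∧ ∀ a b c : ℕ, IsABCTriple a b c → rad a b c ≤ R →
      (c : ℝ) ≤ C * R := by
  intro h
  obtain ⟨N, hN⟩ := exists_triple_gt_real_mul_at_scale C
  obtain ⟨R, hNR, hR⟩ := h N
  obtain ⟨a, b, c, ht, hr, hc⟩ := hN R hNR
  exact absurd (hR a b c ht hr) (not_le.mpr hc)

/-- **The `δ = 0` instance of the crux is false**: `G(R) > R` at every large scale (the crux's
matrix with exponent `1 + 0`). [folklore] -/
theorem not_sparseGoodScalesAt_zero :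
    ¬ ∀ N : ℕ, ∃ R : ℕ, N ≤ R ∧ ∀ a b c : ℕ, IsABCTriple a b c → rad a b c ≤ R →
      (c : ℝ) ≤ (R : ℝ) ^ (1 + (0 : ℝ)) := by
  intro h
  apply not_linearGoodScales 1
  intro N
  obtain ⟨R, hNR, hR⟩ := h N
  refine ⟨R, hNR, fun a b c ht hr => ?_⟩
  have := hR a b c ht hr
  simpa using this

/-- **The side condition `0 < δ` of the crux is sharp**: the fixed-exponent instance of the crux
(its body with `δ` free; the crux is the conjunction of these over `δ > 0`) fails for EVERY `δ ≤ 0`.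
[folklore] -/
theorem not_sparseGoodScalesAt_of_nonpos {δ : ℝ} (hδ : δ ≤ 0) :
    ¬ ∀ N : ℕ, ∃ R : ℕ, N ≤ R ∧ ∀ a b c : ℕ, IsABCTriple a b c → rad a b c ≤ R →
      (c : ℝ) ≤ (R : ℝ) ^ (1 + δ) := by
  intro h
  apply not_sparseGoodScalesAt_zero
  intro N
  obtain ⟨R, hNR, hR⟩ := h (max N 1)
  refine ⟨R, le_trans (le_max_left _ _) hNR, fun a b c ht hr => (hR a b c ht hr).trans ?_⟩
  have hR1 : (1 : ℝ) ≤ R := by exact_mod_cast le_trans (le_max_right N 1) hNR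
  exact Real.rpow_le_rpow_of_exponent_le hR1 (by linarith)

/-- **The uniform-in-`δ` strengthening is false**: there is no unbounded set of scales good for
ALL `δ > 0` simultaneously (that would be the `δ = 0` instance). [folklore] -/
theorem not_sparseGoodScales_uniform :
    ¬ ∀ N : ℕ, ∃ R : ℕ, N ≤ R ∧ ∀ δ : ℝ, 0 < δ → ∀ a b c : ℕ, IsABCTriple a b c → rad a b c ≤ R →
      (c : ℝ) ≤ (R : ℝ) ^ (1 + δ) := by
  intro h
  apply not_sparseGoodScalesAt_zero
  intro N
  obtain ⟨R, hNR, hR⟩ := h (max N 1)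
  have hR1 : (1 : ℝ) ≤ R := by exact_mod_cast le_trans (le_max_right N 1) hNR
  refine ⟨R, le_trans (le_max_left _ _) hNR, fun a b c ht hr => ?_⟩
  -- c ≤ R^(1+δ) for all δ > 0 ⟹ c ≤ R = R^(1+0)
  have key : ∀ δ : ℝ, 0 < δ → (c : ℝ) ≤ (R : ℝ) ^ (1 + δ) := fun δ hδ => hR δ hδ a b c ht hr
  rw [add_zero, Real.rpow_one]
  by_contra hlt
  rw [not_le] at hlt
  -- continuity of δ ↦ R^(1+δ) at 0
  have hcont : ContinuousAt (fun δ : ℝ => (R : ℝ) ^ (1 + δ)) 0 :=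
    ((Real.continuousAt_const_rpow (by linarith)).comp (continuousAt_const.add continuousAt_id))
  have hev : ∀ᶠ δ in nhds (0 : ℝ), (R : ℝ) ^ (1 + δ) < c := by
    have : (fun δ : ℝ => (R : ℝ) ^ (1 + δ)) 0 < c := by simpa using hlt
    exact hcont.eventually (gt_mem_nhds this)
  obtain ⟨η, hη, hηball⟩ := Metric.eventually_nhds_iff.mp hev
  have h1 := hηball (y := η / 2) (by simp [abs_of_pos hη]; linarith)
  have h2 := key (η / 2) (by linarith)
  linarith

end Summit.ABC.ABC.Theorems.SparseGoodScales.Negative
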